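import Literature.NumberTheory.EllipticCurves.ComplexMultiplicationDeuringArtinProofs
import Literature.NumberTheory.EllipticCurves.BSDQuadraticDescentProofs
import Literature.NumberTheory.EllipticCurves.ComplexMultiplicationTwistIsogenyCertProofs
import Literature.NumberTheory.EllipticCurves.ComplexMultiplicationLFunctionIsogenyHoldsProofs
import HarnessLib

/-!
# Deuring's theorem `L(E_K/K, s) = L(E/ℚ, s)²` for the CM curves over `ℚ`: discharge

Sibling *proofs* file (D-0014 append protocol: no definitions, every declaration a theorem) of
`Literature.NumberTheory.EllipticCurves.ComplexMultiplicationShaProofs`. It **discharges the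
named fact `Literature.NumberTheory.EllipticCurves.Deuring_LFunction_baseChange_cmField`**
(Silverman, *Advanced Topics*, Ch. II Thm. 10.5 (Deuring), (a)+(b) in the character-free
combined form vendored there: for `W/ℚ` elliptic with `j(W) ∈ maximalCMJInvariants` and `K` its
CM field, `(W.baseChange K).LFunction = W.LFunction * W.LFunction` in Mathlib's
`ArithmeticFunction ℤ`) as

* `Literature.NumberTheory.EllipticCurves.Deuring_LFunction_baseChange_cmField_holds`,

and (appended) **discharges its prime-by-prime form**
`Literature.NumberTheory.EllipticCurves.Deuring_localEulerFactor_baseChange_cmField` (★ₚ) of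
`ComplexMultiplicationDeuringLocal` — `∏_{w ∣ p} L_w(E_K)⁻¹ = (L_p(E)⁻¹)²` for Mathlib's local
Euler factors at every rational prime `p` (Silverman, *Advanced Topics*, Ch. II
Exercises 2.30–2.32 with the proof of Thm. 10.5(a)) — as

* `Literature.NumberTheory.EllipticCurves.Deuring_localEulerFactor_baseChange_cmField_holds`.

## The printed proof and the proof given here

Silverman proves (a) `L(E/L, s) = L(s, ψ)L(s, ψ̄)` (`K ⊆ L`) and (b) `L(E/L, s) = L(s, ψ_{E/L'})`
(`K ⊄ L`) from the Grössencharacter `ψ` of `E` (II.9.2, II.10.4; Exercises 2.30–2.32 for (b)),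
prime by prime. The tree has no Grössencharacters; its reduction of the combined identity
(`ComplexMultiplicationDeuringArtinProofs`, `Deuring_LFunction_baseChange_cmField_of_artinFormalism`,
proved) runs through three results stated for all elliptic curves over `ℚ`, each of which is by
now a theorem of the tree:

1. **Artin formalism** `L(E_K/K, s) = L(E/ℚ, s) · L(E^{(disc K)}/ℚ, s)` for a quadratic field `K`
   (Ireland–Rosen, Prop. 20.5.4(b)): `WeierstrassCurve.LSeries_baseChange_quadratic_holds`
   (`BSDQuadraticDescentProofs`; place by place via the `ℓ`-adic Tate module,
   `ArtinFormalismQuadraticLocalProofs`, the split places being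
   `WeierstrassCurve.localEulerFactor_baseChange_eq_of_ramificationIdx_eq_one_of_inertiaDeg_eq_one`
   of `ComplexMultiplicationDeuringLocalPlaces`);
2. **the CM twist isogeny** `E ∼_ℚ E^{(d_K)}` for the nine maximal-order CM `j`-invariants
   (Silverman, *Advanced Topics*, II.2; kernel-certified cyclic isogenies):
   `isIsogenous_quadraticTwist_cmFieldDiscr_holds` (`ComplexMultiplicationTwistIsogenyCertProofs`);
3. **Knapp's Thm. 11.67** `L(E, s) = L(E', s)` for `ℚ`-isogenous curves:
   `LFunction_eq_of_isIsogenous_holds` (`ComplexMultiplicationLFunctionIsogenyHoldsProofs`, via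
   `det(1 - σ_p T ∣ (V_ℓ E)_{I_p})` at every prime).

Hence `L(E_K/K, s) = L(E, s) L(E^{(disc K)}, s) = L(E, s)²` on `Re s > 3/2`, and the formal
Dirichlet series agree. This is exactly Deuring's theorem in the vendored form; for the CM curves
the two factors `L(E, s)`, `L(E^{(d_K)}, s) = L(E, s)` are Silverman's `L(s, ψ)`, `L(s, ψ̄)`.

The prime-by-prime route of the printed proof (Exercises 2.30–2.32) is carried out in the tree
as far as the split and ramified primes for all nine `j` (`ComplexMultiplicationDeuringLocal`,
`…LocalPlaces`, `…RamifiedProofs`, `…Ramified1728Proofs`, `…Ramified1728KProofs`: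
`Deuring_LFunction_baseChange_cmField_of_inert`), the inert primes (`a_p = 0`,
`#Ẽ(𝔽_{p²}) = (p + 1)²`) being subsumed here by the `ℓ`-adic Artin formalism.

## The prime-by-prime form (★ₚ)

The same three ingredients are theorems of the tree *one place at a time*, which discharges the
per-prime named fact `Deuring_localEulerFactor_baseChange_cmField` directly (no uniqueness of
Euler factorisations needed): the local Artin formalism
`WeierstrassCurve.finprod_localEulerFactor_baseChange_quadratic` (`BSDQuadraticDescentProofs`:
`∏_{w ∣ v} L_w(E_K, q_w^{-s})⁻¹ = L_v(E, p^{-s})⁻¹ · L_v(E^{(disc K)}, p^{-s})⁻¹` for every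
quadratic `K` and every finite place `v` of `ℚ`), the CM twist isogeny `E ∼_ℚ E^{(disc K)}`
(`isIsogenous_quadraticTwist_discr_of_isCMFieldOfJ` with
`isIsogenous_quadraticTwist_cmFieldDiscr_holds`), and the local form of Knapp 11.67 / Faltings
§5 Kor. 2, `WeierstrassCurve.Isogeny.localPolynomialAt_eq_of_isElliptic` (isogenous curves have
the same local polynomial at every finite place,
`ComplexMultiplicationLFunctionIsogenyHoldsProofs`), so that `L_v(E^{(disc K)}) = L_v(E)` and the
right-hand side is `L_v(E)⁻¹ · L_v(E)⁻¹`
(`WeierstrassCurve.localEulerFactor_baseChange_adicCompletion`). At a split `p` this is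
Silverman's `L_{𝔓'} = L_{𝔓''} = L_p`, at an inert `p` it is `a_p = 0`, `a_{𝔓'} = -2p`, at a
ramified `p` it is `1 = 1²` — obtained uniformly from the `ℓ`-adic Tate module rather than case
by case.

## References

* J. H. Silverman, *Advanced Topics in the Arithmetic of Elliptic Curves*, GTM 151 (1994),
  Ch. II Thm. 10.5 (a), (b) and its proof (PDF pp. 171–172), Exercises 2.30–2.32 (PDF p. 179).
  [SilvermanATAEC1994]
* K. Ireland, M. Rosen, *A Classical Introduction to Modern Number Theory*, 2nd ed., GTM 84
  (1990), Ch. 20 §5, Prop. 20.5.4(b). [IrelandRosen1990]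
* A. W. Knapp, *Elliptic Curves*, Princeton Math. Notes 40 (1992), Thm. 11.67. [Knapp1993]
-/

noncomputable section

namespace Literature.NumberTheory.EllipticCurves

/-- **Deuring's theorem (Silverman, *Advanced Topics*, II.10.5 (a)+(b)), discharged**: for every
elliptic `W/ℚ` with `j(W) ∈ maximalCMJInvariants` and every number field `K` with
`IsCMFieldOfJ K (j W)` (its CM field), `(W.baseChange K).LFunction = W.LFunction * W.LFunction`.
Proof: `Deuring_LFunction_baseChange_cmField_of_artinFormalism` fed with the three theorems of
the tree `WeierstrassCurve.LSeries_baseChange_quadratic_holds` (Artin formalism for quadratic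
base change), `isIsogenous_quadraticTwist_cmFieldDiscr_holds` (`E ∼ E^{(d_K)}`) and
`LFunction_eq_of_isIsogenous_holds` (Knapp 11.67).
[cite: SilvermanATAEC1994, Ch. II Thm. 10.5 (a), (b) (PDF p. 171) with Exercises 2.30–2.32 (PDF p. 179)] -/
theorem Deuring_LFunction_baseChange_cmField_holds : Deuring_LFunction_baseChange_cmField :=
  Deuring_LFunction_baseChange_cmField_of_artinFormalism
    WeierstrassCurve.LSeries_baseChange_quadratic_holds
    isIsogenous_quadraticTwist_cmFieldDiscr_holds LFunction_eq_of_isIsogenous_holds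

/-- **Deuring's theorem prime by prime (★ₚ), discharged**: for every elliptic `W/ℚ` with
`j(W) ∈ maximalCMJInvariants`, every number field `K` with `IsCMFieldOfJ K (j W)` (its CM
field) and every finite place `v` of `ℚ`,
`∏ᶠ_{w ∣ v} L_w(W_K, q_w^{-s})⁻¹ = (L_v(W, p^{-s})⁻¹)²` for Mathlib's local Euler factors on the
completions (Silverman, *Advanced Topics*, Ch. II Exercises 2.30–2.32 with the proof of
Thm. 10.5(a): split `L_{𝔓'} = L_{𝔓''} = L_p`, inert `1 + pT'` at `T' = T²` against `1 + pT²`,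
ramified `1 = 1²`). Proof: the local Artin formalism
`WeierstrassCurve.finprod_localEulerFactor_baseChange_quadratic` gives
`∏ᶠ_{w ∣ v} L_w(W_K)⁻¹ = L_v(W)⁻¹ · L_v(W^{(disc K)})⁻¹`; `W ∼_ℚ W^{(disc K)}`
(`isIsogenous_quadraticTwist_discr_of_isCMFieldOfJ`,
`isIsogenous_quadraticTwist_cmFieldDiscr_holds`) and isogenous curves have the same local
polynomial at `v` (`WeierstrassCurve.Isogeny.localPolynomialAt_eq_of_isElliptic`), hence the same
local Euler factor (`WeierstrassCurve.localEulerFactor_baseChange_adicCompletion`).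
[cite: SilvermanATAEC1994, Ch. II Exercises 2.30–2.32 (PDF p. 179) with Thm. 10.5 (a) and its proof (PDF pp. 171–172)] -/
theorem Deuring_localEulerFactor_baseChange_cmField_holds :
    Deuring_localEulerFactor_baseChange_cmField := by
  intro W _ hj K _ _ hK v
  have hd : ((NumberField.discr K : ℤ) : ℚ) ≠ 0 := by
    exact_mod_cast NumberField.discr_ne_zero K
  haveI := W.isElliptic_quadraticTwist hd
  obtain ⟨φ⟩ := isIsogenous_quadraticTwist_discr_of_isCMFieldOfJ
    isIsogenous_quadraticTwist_cmFieldDiscr_holds W hj K hK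
  rw [W.finprod_localEulerFactor_baseChange_quadratic K hK.1 v,
    W.localEulerFactor_baseChange_adicCompletion v,
    (W.quadraticTwist (NumberField.discr K : ℚ)).localEulerFactor_baseChange_adicCompletion v,
    ← φ.localPolynomialAt_eq_of_isElliptic v, sq]

end Literature.NumberTheory.EllipticCurves

end
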